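import Summits.QuantumFields.BalabanUV.T4Continuum.Support.NE7SliceCriticalBranch
import Summits.QuantumFields.BalabanUV.T4Continuum.Support.NE7MinimalActionDifferentiable
import HarnessLib

/-!
# NE7MinimiserC1Generic — THE CONSTRAINED MINIMISER `U_k(V)` IS `C¹` IN THE DATUM `V` AT GENERIC DATA (ROAD-G114 §9 (S6), [B11] p.279 claims analyticity): over the small data, at a
# GENERIC datum `V₀` (its unitary `N`-periodic stabilisers are constant central gauges) and every level `j+1`, there are a minimiser `U♯` over `V₀` and a `C¹` germ
# `Ψ : skewSub N → skewSub(L·tower j)`, `Ψ(0) = 0`, such that `chart_{U♯} Ψ(y)` is a minimiser over `chart_{V₀} y` for all small `y` (the minimiser section in the trivial-corner slice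
# gauge through `U♯`), and the minimal action `y ↦ minAct(chart_{V₀} y)` is `C¹` at `0`.  Assembly of ✓ p823122 (Lipschitz copies in the chart), the slice package and critical branch
# (S5 `slice_critical_branch`), slice decoding (✓ p823513) and genericity; the minimiser in slice-fibre coordinates is a local minimum of `z ↦ g(y, z)`, hence THE critical point `z⋆(y)`

Cell `pub-balaban`, rung (B)+1 sub-cell t4, lineage `b2b-balaban-t4-ne7-p1` (CRUX PROVER NE7 #1 = OWNER of BINDER row NE7), generation 114.  Memo `t4/b2b-balaban-t4-ne7-p1-g114/ROAD-G114.md` §9.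
WHAT ([folklore]; 0 def, 0 sorry; `d = 4`, every `U(n)`, `L ≥ 2`).  **`minimiser_contDiffAt_generic`**.
HONEST FRAMING (page 1): composition of landed kernel theorems; radii∕constants existential; genericity of the datum is a HYPOTHESIS (non-generic data: memo §8); `C¹`, NOT the analyticity
[B11] asserts; nothing of Bałaban's asserted; NOT NE7 as a spine node, NOT NE3; spine 0∕9; finite T⁴ rung (B)+1 — NOT infinite volume, NOT mass gap, NOT BetaPertH, NOT Clay.
-/

set_option autoImplicit false

open scoped BigOperators Matrix Matrix.Norms.L2Operator Topology
open NormedSpace Finset Set Filter Metric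

namespace Summit.QuantumFields.BalabanUV.T4Continuum.NE7MinimiserC1Generic

open Literature.MathematicalPhysics.QuantumFieldTheory.Balaban1983to89
open B7Prop1Explicit B7Prop2Explicit MatrixLog
open T4AveragingDeficitWall (IsUnitaryCfg SmallField fineAction expUnit_zero)
open T4AveragingDeficitWallBoundary (IsPeriodicCfg)
open AveragingDeficitTorusChart (TDir chart chartDir chart_zero chart_smul redN isPeriodicCfg_chart isUnitaryCfg_chart)
open AveragingDeficitChartCalculus (relLog contDiffAt_fineAction_chart)
open AveragingDeficitTwoLevelPrep (skewSub skewPR)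
open AveragingDeficitMultiLevelPrep (tower levelQ cavgIter tower_ne_zero)
open AveragingDeficitMultiLevelBridge (cavgIter_eq_avgIter)
open MinimalActionLevels (perWin levelAction stepWt stepWt_pos)
open MinimalActionSandwich (IsMinimiser admissible minAct)
open MinimalActionRate (sfClass)
open NE3EnergyShapes (IsUnitarySite IsPeriodicSite gaugeAct_one)
open NE7AdmissibleFibreLHC (period_succ_eq continuous_chart chart_id_eq_chart_skewP)
open NE7MinimalOrbitDatumContinuity (thresholds minAct_continuous)
open NE7MinimalOrbitUniqueGeneric (minimal_orbit_unique_generic)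
open NE7EtaMinimiserGaugeCovariance (isMinimiser_gaugeAct avgIter_gaugeAct_sfClass isUnitarySite_corner)
open NE7MinimiserLipschitzPrep (isPeriodicSite_corner norm_vary_sub_le gaugeAct_mul_fun)
open NE7MinimiserLipschitzChart (minimiser_lipschitz_chart)
open BlockAverageCurrent (smallField_gaugeAct)
open NE7GaugeActionChart (gaugeChart_val)
open NE7GaugeSliceMapFacts (chart_sliceMap expGauge_isUnitarySite expGauge_isPeriodicSite)
open NE7SliceCriticalBranch (slice_critical_branch)

noncomputable section

variable {n : Type} [Fintype n] [DecidableEq n]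

set_option maxHeartbeats 2400000 in
/-- **`U_k(V)` IS `C¹` IN `V` AT GENERIC DATA, AND SO IS THE MINIMAL ACTION** (see the module docstring).  `∃ ε₀ > 0, ∀ 0 < ε ≤ ε₀, ∀ N ≥ 1, ∃ δ_V > 0`, for every unitary `N`-periodic
`V₀` with `SmallField V₀ δ_V` whose unitary `N`-periodic stabilisers are constant central gauges, and every `j`: `∃ U♯ Ψ`, `U♯` a minimiser over `V₀`, `Ψ` `C¹` at `0` with
`Ψ 0 = 0`, `chart_{U♯} Ψ(y)` a minimiser over `chart_{V₀} y` for `y` near `0`, and `y ↦ minAct(chart_{V₀} y)` `C¹` at `0`. [folklore] -/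
theorem minimiser_contDiffAt_generic [Nonempty n] {L : ℕ} [NeZero L] (hL : 2 ≤ L) :
    ∃ ε₀ : ℝ, 0 < ε₀ ∧ ∀ ε : ℝ, 0 < ε → ε ≤ ε₀ → ∀ (N : ℕ) [NeZero N], 1 ≤ N →
      ∃ δV : ℝ, 0 < δV ∧
        ∀ V₀ ∈ {V : Site 4 → Fin 4 → (Matrix n n ℂ)ˣ | IsUnitaryCfg V ∧ IsPeriodicCfg V (N : ℤ) ∧ SmallField V δV},
        (∀ s : Site 4 → (Matrix n n ℂ)ˣ, IsUnitarySite s → IsPeriodicSite s (N : ℤ) → gaugeAct s V₀ = V₀ →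
            (∀ z : Site 4, s z = s 0) ∧ ∀ A : Matrix n n ℂ, (s 0 : Matrix n n ℂ) * A = A * (s 0 : Matrix n n ℂ)) →
        ∀ j : ℕ, ∃ (Us : Site 4 → Fin 4 → (Matrix n n ℂ)ˣ) (Ψ : ↥(skewSub 4 n N) → ↥(skewSub 4 n (L * tower L N j))),
          IsMinimiser 4 (sfClass 4 L N ε) L N (j + 1) V₀ Us ∧ ContDiffAt ℝ 1 Ψ 0 ∧ Ψ 0 = 0 ∧
          (∀ᶠ y : ↥(skewSub 4 n N) in 𝓝 0, IsMinimiser 4 (sfClass 4 L N ε) L N (j + 1) (chart (ContinuousLinearMap.id ℝ (Matrix n n ℂ)) N V₀ (y : TDir 4 n N))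
            (chart (ContinuousLinearMap.id ℝ (Matrix n n ℂ)) (L * tower L N j) Us ((Ψ y : ↥(skewSub 4 n (L * tower L N j))) : TDir 4 n (L * tower L N j)))) ∧
          ContDiffAt ℝ 1 (fun y : ↥(skewSub 4 n N) => minAct 4 (sfClass 4 L N ε) L N (j + 1) (chart (ContinuousLinearMap.id ℝ (Matrix n n ℂ)) N V₀ (y : TDir 4 n N))) 0 := by
  have hL1 : 1 ≤ L := by omega
  obtain ⟨ε₁, hε₁, H⟩ := thresholds (n := n) hL
  obtain ⟨ε₂, hε₂, H2⟩ := minAct_continuous (n := n) hL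
  obtain ⟨ε₃, hε₃, H3⟩ := minimal_orbit_unique_generic (n := n) hL
  obtain ⟨ε₄, hε₄, H4⟩ := minimiser_lipschitz_chart (n := n) hL
  obtain ⟨ε₅, hε₅, H5⟩ := slice_critical_branch (n := n) hL
  refine ⟨min ε₁ (min ε₂ (min ε₃ (min ε₄ ε₅))), lt_min hε₁ (lt_min hε₂ (lt_min hε₃ (lt_min hε₄ hε₅))), fun ε hε hεle N _ hN => ?_⟩
  obtain ⟨-, -, hls, H1⟩ := H ε hε (hεle.trans (min_le_left _ _))
  obtain ⟨δ₁, hδ₁, hint₁⟩ := H1 N hN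
  obtain ⟨δ₂, hδ₂, hcont⟩ := H2 ε hε (hεle.trans ((min_le_right _ _).trans (min_le_left _ _))) N hN
  obtain ⟨δ₃, hδ₃, huniq⟩ := H3 ε hε (hεle.trans ((min_le_right _ _).trans ((min_le_right _ _).trans (min_le_left _ _)))) N hN
  obtain ⟨δ₄, hδ₄, hlip⟩ := H4 ε hε (hεle.trans ((min_le_right _ _).trans ((min_le_right _ _).trans ((min_le_right _ _).trans (min_le_left _ _))))) N hN
  have hS5 := H5 ε hε (hεle.trans ((min_le_right _ _).trans ((min_le_right _ _).trans ((min_le_right _ _).trans (min_le_right _ _))))) N hN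
  refine ⟨min δ₁ (min δ₂ (min δ₃ δ₄)), lt_min hδ₁ (lt_min hδ₂ (lt_min hδ₃ hδ₄)), fun V₀ hV₀ hgen j => ?_⟩
  obtain ⟨hV₀u, hV₀P, hV₀δ⟩ := hV₀
  have hV₀1 : V₀ ∈ {V : Site 4 → Fin 4 → (Matrix n n ℂ)ˣ | IsUnitaryCfg V ∧ IsPeriodicCfg V (N : ℤ) ∧ SmallField V δ₁} :=
    ⟨hV₀u, hV₀P, MinimalActionRate.SmallField.mono hV₀δ (min_le_left _ _)⟩
  have hV₀2 : V₀ ∈ {V : Site 4 → Fin 4 → (Matrix n n ℂ)ˣ | IsUnitaryCfg V ∧ IsPeriodicCfg V (N : ℤ) ∧ SmallField V δ₂} :=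
    ⟨hV₀u, hV₀P, MinimalActionRate.SmallField.mono hV₀δ ((min_le_right _ _).trans (min_le_left _ _))⟩
  have hV₀3 : V₀ ∈ {V : Site 4 → Fin 4 → (Matrix n n ℂ)ˣ | IsUnitaryCfg V ∧ IsPeriodicCfg V (N : ℤ) ∧ SmallField V δ₃} :=
    ⟨hV₀u, hV₀P, MinimalActionRate.SmallField.mono hV₀δ ((min_le_right _ _).trans ((min_le_right _ _).trans (min_le_left _ _)))⟩
  have hV₀4 : V₀ ∈ {V : Site 4 → Fin 4 → (Matrix n n ℂ)ˣ | IsUnitaryCfg V ∧ IsPeriodicCfg V (N : ℤ) ∧ SmallField V δ₄} :=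
    ⟨hV₀u, hV₀P, MinimalActionRate.SmallField.mono hV₀δ ((min_le_right _ _).trans ((min_le_right _ _).trans (min_le_right _ _)))⟩
  -- genericity in the form «stabilisers act trivially on every configuration»
  have hgen1 : ∀ s : Site 4 → (Matrix n n ℂ)ˣ, IsUnitarySite s → IsPeriodicSite s (N : ℤ) → gaugeAct s V₀ = V₀ →
      ∀ D : Site 4 → Fin 4 → (Matrix n n ℂ)ˣ, gaugeAct s D = D := by
    intro s hsu hsP hsfix D
    obtain ⟨hconst, hcen⟩ := hgen s hsu hsP hsfix
    have hcenU : ∀ W : (Matrix n n ℂ)ˣ, s 0 * W = W * s 0 := fun W => Units.ext (by rw [Units.val_mul, Units.val_mul]; exact hcen W)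
    funext x κ
    show s x * D x κ * (s (x + e κ))⁻¹ = D x κ
    rw [hconst x, hconst (x + e κ), hcenU (D x κ), mul_inv_cancel_right]
  -- the Lipschitz-chart minimiser `U♯` over `V₀` and its interiority (via the orbit of an interior minimiser)
  obtain ⟨Us, hUs, C, hC, hlipev⟩ := hlip V₀ hV₀4 j
  obtain ⟨U₀, hU₀, a, ha0, haε, hU₀a⟩ := hint₁ V₀ hV₀1 (j + 1)
  obtain ⟨Ur, -, horbit⟩ := huniq V₀ hV₀3 (j + 1)
  obtain ⟨u₁, hu₁, -, hg₁⟩ := horbit U₀ hU₀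
  obtain ⟨u₂, hu₂, -, hg₂⟩ := horbit Us hUs
  have hUsa : SmallField Us a := by
    have h1 : SmallField Ur a := by rw [← hg₁]; exact smallField_gaugeAct hu₁ hU₀a
    have h2 : gaugeAct (fun z => (u₂ z)⁻¹) Ur = Us := by rw [← hg₂, AveragingDeficitKDatum.gaugeAct_inv_gaugeAct]
    rw [← h2]; exact smallField_gaugeAct (fun z => (unitaryUnits _).inv_mem (hu₂ z)) h1
  haveI : NeZero (L * tower L N j) := ⟨Nat.mul_ne_zero (NeZero.ne L) (tower_ne_zero L N j)⟩
  letI : NormedAlgebra ℚ (Matrix n n ℂ) := NormedAlgebra.restrictScalars ℚ ℂ (Matrix n n ℂ)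
  have hper : N * L ^ (j + 1) = L * tower L N j := period_succ_eq L N j
  have hUsU : IsUnitaryCfg Us := hUs.mem.1.1
  have hUsP : IsPeriodicCfg Us ((L * tower L N j : ℕ) : ℤ) := by have h := hUs.mem.1.2.1; rwa [hper] at h
  have hUsavg : cavgIter L (j + 1) Us = V₀ := by rw [cavgIter_eq_avgIter]; exact hUs.mem.2
  set w : ℝ := ((stepWt 4 L)⁻¹) ^ (j + 1) with hw
  have hw0 : 0 < w := pow_pos (inv_pos.mpr (stepWt_pos (d := 4) L hL1)) _
  have hlev : ∀ Z : Site 4 → Fin 4 → (Matrix n n ℂ)ˣ, levelAction 4 L N (j + 1) Z = w * fineAction Z (perWin 4 (N * L ^ (j + 1))) := fun Z => by rw [hw]; rfl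
  -- (S5) the slice package and the critical branch at `(V₀, U♯)`
  obtain ⟨Sl, ξ, σ, θS, KT, iK, πT, zs, hSlle, hξc, hσc, hξ0, hσ0, hprop, hright, hθSc, hθS0, hfibS, hiK, hπT0, hπTsec, ⟨Kp, hπTK⟩, hgc, hzsc, hzs0, -, hzsuniq⟩ :=
    hS5 V₀ j Us hV₀u hV₀P hUs a ha0 haε hUsa hgen
  haveI : CompleteSpace ↥Sl := FiniteDimensional.complete ℝ _
  haveI : CompleteSpace ↥KT := FiniteDimensional.complete ℝ _
  set ch : ↥(skewSub 4 n (L * tower L N j)) → (Site 4 → Fin 4 → (Matrix n n ℂ)ˣ) := fun Φ =>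
    chart (ContinuousLinearMap.id ℝ (Matrix n n ℂ)) (L * tower L N j) Us (Φ : TDir 4 n (L * tower L N j)) with hch
  set g : ↥(skewSub 4 n N) × ↥KT → ℝ := fun p : ↥(skewSub 4 n N) × ↥KT =>
    fineAction (chart (ContinuousLinearMap.id ℝ (Matrix n n ℂ)) (L * tower L N j) Us ((θS (p.1, iK p.2) : ↥Sl) : TDir 4 n (L * tower L N j)))
      (perWin 4 (N * L ^ (j + 1))) with hg
  -- the section `Ψ`
  set inclSl : ↥Sl →L[ℝ] ↥(skewSub 4 n (L * tower L N j)) := LinearMap.toContinuousLinearMap (Submodule.inclusion hSlle) with hinclSl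
  set Ψ : ↥(skewSub 4 n N) → ↥(skewSub 4 n (L * tower L N j)) := fun y => inclSl (θS (y, iK (zs y))) with hΨ
  have hΨval : ∀ y, ((Ψ y : ↥(skewSub 4 n (L * tower L N j))) : TDir 4 n (L * tower L N j)) = ((θS (y, iK (zs y)) : ↥Sl) : TDir 4 n (L * tower L N j)) :=
    fun y => rfl
  have hsec : ContDiffAt ℝ 1 (fun y : ↥(skewSub 4 n N) => ((y, iK (zs y)) : ↥(skewSub 4 n N) × ↥Sl)) 0 :=
    contDiffAt_id.prodMk (iK.contDiff.contDiffAt.comp 0 hzsc)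
  have hsec0 : (fun y : ↥(skewSub 4 n N) => ((y, iK (zs y)) : ↥(skewSub 4 n N) × ↥Sl)) 0 = 0 := by
    simp only [hzs0, map_zero, Prod.mk_zero_zero]
  have hθsec : ContDiffAt ℝ 1 (fun y : ↥(skewSub 4 n N) => θS (y, iK (zs y))) 0 := by
    have h1 : ContDiffAt ℝ 1 θS ((fun y : ↥(skewSub 4 n N) => ((y, iK (zs y)) : ↥(skewSub 4 n N) × ↥Sl)) 0) := by
      rw [hsec0]; exact hθSc.of_le (by norm_num)
    exact h1.comp 0 hsec
  have hΨc : ContDiffAt ℝ 1 Ψ 0 := inclSl.contDiff.contDiffAt.comp 0 hθsec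
  have hΨ0 : Ψ 0 = 0 := by simp only [hΨ, hzs0, map_zero]; rw [Prod.mk_zero_zero, hθS0, map_zero]
  -- the data `D_y = chart_{V₀} y`
  set Dy : ↥(skewSub 4 n N) → (Site 4 → Fin 4 → (Matrix n n ℂ)ˣ) := fun y => chart (ContinuousLinearMap.id ℝ (Matrix n n ℂ)) N V₀ (y : TDir 4 n N) with hDy
  have hDyu : ∀ y, IsUnitaryCfg (Dy y) := fun y => by
    show IsUnitaryCfg (chart (ContinuousLinearMap.id ℝ (Matrix n n ℂ)) N V₀ (y : TDir 4 n N))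
    rw [chart_id_eq_chart_skewP V₀ y.2]; exact isUnitaryCfg_chart N hV₀u _
  have hDyP : ∀ y, IsPeriodicCfg (Dy y) (N : ℤ) := fun y => isPeriodicCfg_chart _ N hV₀P _
  have hDyt : Tendsto Dy (𝓝 0) (𝓝 V₀) := by
    have h := ((continuous_chart (ContinuousLinearMap.id ℝ (Matrix n n ℂ)) N V₀).comp continuous_subtype_val).tendsto (0 : ↥(skewSub 4 n N))
    rwa [Function.comp_apply, Submodule.coe_zero, chart_zero] at h
  have hDynear : ∀ y : ↥(skewSub 4 n N), ‖y‖ ≤ 1 / 8 → ∀ (r : Fin 4 → Fin N) (κ' : Fin 4),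
      ‖(((V₀ (boxVec N r) κ')⁻¹ : (Matrix n n ℂ)ˣ) : Matrix n n ℂ) * ((Dy y (boxVec N r) κ' : (Matrix n n ℂ)ˣ) : Matrix n n ℂ) - 1‖ ≤ 1 / 4 := by
    intro y hy r κ'
    have hcv : Dy y = T4AveragingDeficitWall.vary V₀ (chartDir (ContinuousLinearMap.id ℝ (Matrix n n ℂ)) N (y : TDir 4 n N)) 1 := by
      show chart _ N V₀ _ = _; rw [← chart_smul, one_smul]
    have hcomp : ‖chartDir (ContinuousLinearMap.id ℝ (Matrix n n ℂ)) N (y : TDir 4 n N) (boxVec N r) κ'‖ ≤ ‖y‖ := by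
      simp only [chartDir, ContinuousLinearMap.id_apply]
      rw [Submodule.coe_norm]
      exact (norm_le_pi_norm ((y : TDir 4 n N) (redN N (boxVec N r))) κ').trans (norm_le_pi_norm _ _)
    rw [hcv]
    exact (norm_vary_sub_le (W := V₀) (boxVec N r) κ' (hcomp.trans (by linarith))).trans (by linarith)
  have hDycoord : ∀ y : ↥(skewSub 4 n N), ‖y‖ ≤ 1 / 8 → skewPR N (relLog N V₀ (Dy y)) = y := fun y hy =>
    NE7MinimalActionDifferentiable.skewPR_relLog_chart_self V₀ y (lt_of_le_of_lt hy (by have := Real.log_two_gt_d9; linarith))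
  -- existence of minimisers near `V₀`
  obtain ⟨Us2, hUs2, hexist⟩ := hcont V₀ hV₀2 (j + 1)
  have hexev : ∀ᶠ V in 𝓝 V₀, IsUnitaryCfg V → IsPeriodicCfg V (N : ℤ) → ∃ U, IsMinimiser 4 (sfClass 4 L N ε) L N (j + 1) V U :=
    (hexist 1 one_pos).mono fun V hV hVu hVP => (hV hVu hVP).1
  -- decoding of the slice decomposition: `chart Φ = (chart σΦ)^{exp ξΦ}` for small `Φ`
  have hcontb : ∀ (r : Fin 4 → Fin (L * tower L N j)) (κ : Fin 4), Continuous fun q : ((Fin 4 → Fin (L * tower L N j)) → Matrix n n ℂ) × TDir 4 n (L * tower L N j) =>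
      (((Us (boxVec (L * tower L N j) r) κ)⁻¹ : (Matrix n n ℂ)ˣ) : Matrix n n ℂ) * (exp (q.1 r) * ((Us (boxVec (L * tower L N j) r) κ : Matrix n n ℂ) * exp (q.2 r κ))
        * exp (-(q.1 (redN (L * tower L N j) (boxVec (L * tower L N j) r + e κ))))) := by
    intro r κ
    have e1 : Continuous fun q : ((Fin 4 → Fin (L * tower L N j)) → Matrix n n ℂ) × TDir 4 n (L * tower L N j) => q.1 r :=
      (continuous_apply r).comp continuous_fst
    have e2' : Continuous fun q : ((Fin 4 → Fin (L * tower L N j)) → Matrix n n ℂ) × TDir 4 n (L * tower L N j) => q.2 r :=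
      (continuous_apply r).comp continuous_snd
    have e2 : Continuous fun q : ((Fin 4 → Fin (L * tower L N j)) → Matrix n n ℂ) × TDir 4 n (L * tower L N j) => q.2 r κ :=
      (continuous_apply κ).comp e2'
    have e3 : Continuous fun q : ((Fin 4 → Fin (L * tower L N j)) → Matrix n n ℂ) × TDir 4 n (L * tower L N j) =>
        q.1 (redN (L * tower L N j) (boxVec (L * tower L N j) r + e κ)) := (continuous_apply _).comp continuous_fst
    exact continuous_const.mul (((NormedSpace.exp_continuous.comp e1).mul (continuous_const.mul (NormedSpace.exp_continuous.comp e2))).mul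
      (NormedSpace.exp_continuous.comp e3.neg))
  have hnearq : ∀ᶠ q : ((Fin 4 → Fin (L * tower L N j)) → Matrix n n ℂ) × TDir 4 n (L * tower L N j) in 𝓝 0,
      ∀ (r : Fin 4 → Fin (L * tower L N j)) (κ : Fin 4), ‖(((Us (boxVec (L * tower L N j) r) κ)⁻¹ : (Matrix n n ℂ)ˣ) : Matrix n n ℂ)
        * ((gaugeAct (fun x : Site 4 => expUnit (q.1 (redN (L * tower L N j) x))) (chart (ContinuousLinearMap.id ℝ (Matrix n n ℂ)) (L * tower L N j) Us q.2)
            (boxVec (L * tower L N j) r) κ : (Matrix n n ℂ)ˣ) : Matrix n n ℂ) - 1‖ ≤ 1 / 4 := by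
    refine Filter.eventually_all.mpr fun r => Filter.eventually_all.mpr fun κ => ?_
    have h0 : ‖(((Us (boxVec (L * tower L N j) r) κ)⁻¹ : (Matrix n n ℂ)ˣ) : Matrix n n ℂ)
        * (exp ((0 : ((Fin 4 → Fin (L * tower L N j)) → Matrix n n ℂ) × TDir 4 n (L * tower L N j)).1 r)
          * ((Us (boxVec (L * tower L N j) r) κ : Matrix n n ℂ) * exp ((0 : ((Fin 4 → Fin (L * tower L N j)) → Matrix n n ℂ) × TDir 4 n (L * tower L N j)).2 r κ))
          * exp (-((0 : ((Fin 4 → Fin (L * tower L N j)) → Matrix n n ℂ) × TDir 4 n (L * tower L N j)).1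
            (redN (L * tower L N j) (boxVec (L * tower L N j) r + e κ))))) - 1‖ < 1 / 4 := by
      simp only [Prod.fst_zero, Prod.snd_zero, Pi.zero_apply, exp_zero, neg_zero, one_mul, mul_one, Units.inv_mul, sub_self, norm_zero]; norm_num
    have hev := ((((hcontb r κ).sub continuous_const).norm).continuousAt
      (x := (0 : ((Fin 4 → Fin (L * tower L N j)) → Matrix n n ℂ) × TDir 4 n (L * tower L N j)))).eventually (gt_mem_nhds h0)
    filter_upwards [hev] with q hq
    rw [gaugeChart_val]
    exact hq.le
  have htΛ : Tendsto (fun Φ : ↥(skewSub 4 n (L * tower L N j)) => (ξ Φ, ((σ Φ : ↥(skewSub 4 n (L * tower L N j))) : TDir 4 n (L * tower L N j))))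
      (𝓝 0) (𝓝 0) := by
    have h1 := hξc.continuousAt; rw [ContinuousAt, hξ0] at h1
    have h2 := hσc.continuousAt; rw [ContinuousAt, hσ0] at h2
    have h3 := ((skewSub 4 n (L * tower L N j)).subtypeL.continuous.tendsto (0 : ↥(skewSub 4 n (L * tower L N j)))).comp h2
    rw [map_zero] at h3
    have h := h1.prodMk_nhds h3; rwa [Prod.mk_zero_zero] at h
  have hdecode : ∀ᶠ Φ : ↥(skewSub 4 n (L * tower L N j)) in 𝓝 0,
      ch Φ = gaugeAct (fun x : Site 4 => expUnit (ξ Φ (redN (L * tower L N j) x))) (ch (σ Φ)) := by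
    filter_upwards [hright, htΛ.eventually hnearq] with Φ hr hn
    have h := chart_sliceMap hUsU hUsP (hprop Φ).1 (σ Φ) hn
    rw [hr] at h
    exact h
  -- radii
  obtain ⟨ρd, hρd, hdecB⟩ := Metric.eventually_nhds_iff.mp hdecode
  obtain ⟨Kσ, tσ, htσ, hσL⟩ := (hσc.of_le (by norm_num : (1 : WithTop ℕ∞) ≤ 2)).exists_lipschitzOnWith
  obtain ⟨ρσ, hρσ, hballσ⟩ := Metric.mem_nhds_iff.mp htσ
  obtain ⟨ρs, hρs, hsecB⟩ := Metric.eventually_nhds_iff.mp hπTsec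
  obtain ⟨ρk, hρk, hπKB⟩ := Metric.eventually_nhds_iff.mp hπTK
  obtain ⟨ρf, hρf, hfibB⟩ := Metric.eventually_nhds_iff.mp hfibS
  obtain ⟨ρu, hρu, huniqB⟩ := Metric.eventually_nhds_iff.mp hzsuniq
  set Kq : ℝ := max Kp 0 with hKq
  have hKq0 : 0 ≤ Kq := le_max_right _ _
  have hiKn : ∀ z : ↥KT, ‖iK z‖ = ‖z‖ := fun z => by rw [Submodule.coe_norm, Submodule.coe_norm (x := z), hiK z]
  -- the master radius and the bookkeeping constant
  set ρm : ℝ := min (1 / 8) (min ρd (min ρσ (min ρs (min ρk (min ρf ρu))))) with hρm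
  have hρm0 : 0 < ρm := lt_min (by norm_num) (lt_min hρd (lt_min hρσ (lt_min hρs (lt_min hρk (lt_min hρf hρu)))))
  have hρm8 : ρm ≤ 1 / 8 := min_le_left _ _
  have hρmd : ρm ≤ ρd := (min_le_right _ _).trans (min_le_left _ _)
  have hρmσ : ρm ≤ ρσ := (min_le_right _ _).trans ((min_le_right _ _).trans (min_le_left _ _))
  have hρms : ρm ≤ ρs := (min_le_right _ _).trans ((min_le_right _ _).trans ((min_le_right _ _).trans (min_le_left _ _)))
  have hρmk : ρm ≤ ρk := (min_le_right _ _).trans ((min_le_right _ _).trans ((min_le_right _ _).trans ((min_le_right _ _).trans (min_le_left _ _))))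
  have hρmf : ρm ≤ ρf :=
    (min_le_right _ _).trans ((min_le_right _ _).trans ((min_le_right _ _).trans ((min_le_right _ _).trans ((min_le_right _ _).trans (min_le_left _ _)))))
  have hρmu : ρm ≤ ρu :=
    (min_le_right _ _).trans ((min_le_right _ _).trans ((min_le_right _ _).trans ((min_le_right _ _).trans ((min_le_right _ _).trans (min_le_right _ _)))))
  set B : ℝ := 1 + C + (Kσ : ℝ) * C + Kq * ((Kσ : ℝ) * C) with hB
  have hKσ0 : 0 ≤ (Kσ : ℝ) := NNReal.coe_nonneg Kσ
  have hB0 : 0 < B := by rw [hB]; positivity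
  have hysmall : ∀ᶠ y : ↥(skewSub 4 n N) in 𝓝 0, B * ‖y‖ < ρm := by
    have h : ∀ᶠ y : ↥(skewSub 4 n N) in 𝓝 0, ‖y‖ < ρm / B :=
      Filter.eventually_of_mem (Metric.ball_mem_nhds (0 : ↥(skewSub 4 n N)) (div_pos hρm0 hB0)) fun q hq => by rwa [mem_ball_zero_iff] at hq
    exact h.mono fun y hy => by rw [lt_div_iff₀ hB0] at hy; linarith
  -- THE KEY STATEMENT: for small `y`, `chart_{U♯} Ψ(y)` is a minimiser over `D_y`
  have hkey : ∀ᶠ y : ↥(skewSub 4 n N) in 𝓝 0, IsMinimiser 4 (sfClass 4 L N ε) L N (j + 1) (Dy y) (ch (Ψ y)) := by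
    filter_upwards [hysmall, hDyt.eventually hexev, hDyt.eventually hlipev] with y hyB hyex hylip
    have hy0 : 0 ≤ ‖y‖ := norm_nonneg y
    have hBt : B * ‖y‖ = ‖y‖ + C * ‖y‖ + (Kσ : ℝ) * C * ‖y‖ + Kq * ((Kσ : ℝ) * C) * ‖y‖ := by rw [hB]; ring
    have hnn1 : 0 ≤ C * ‖y‖ := mul_nonneg hC hy0
    have hnn2 : 0 ≤ (Kσ : ℝ) * C * ‖y‖ := by positivity
    have hnn3 : 0 ≤ Kq * ((Kσ : ℝ) * C) * ‖y‖ := by positivity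
    have hyρ : ‖y‖ < ρm := by linarith
    have hy8 : ‖y‖ ≤ 1 / 8 := (hyρ.trans_le hρm8).le
    have hyn := hDynear y hy8
    have hyco := hDycoord y hy8
    obtain ⟨Uy, hUy⟩ := hyex (hDyu y) (hDyP y)
    obtain ⟨u, Φ, hu, huP, hufix, hcopy, hΦn⟩ := hylip (hDyu y) (hDyP y) Uy hUy
    rw [hyco] at hΦn
    -- corner values of `u` fix `V₀`, hence act trivially (genericity): `chart Φ` is a minimiser over `D_y`
    set ub : Site 4 → (Matrix n n ℂ)ˣ := fun z : Site 4 => u (((L : ℤ) ^ (j + 1)) • z) with hub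
    have hubu : IsUnitarySite ub := fun z => isUnitarySite_corner hu _ z
    have hubP : IsPeriodicSite ub (N : ℤ) := by
      have h : IsPeriodicSite (fun z : Site 4 => u (((L ^ (j + 1) : ℕ) : ℤ) • z)) (N : ℤ) := isPeriodicSite_corner huP
      simpa only [Nat.cast_pow] using h
    have hubfix : gaugeAct ub V₀ = V₀ := by
      funext z κ; exact Units.ext (by have h := hufix z κ; simpa only [hub, gaugeAct, Units.val_mul] using h)
    have hXmin : IsMinimiser 4 (sfClass 4 L N ε) L N (j + 1) (Dy y) (ch Φ) := by
      have h : IsMinimiser 4 (sfClass 4 L N ε) L N (j + 1) (gaugeAct ub (Dy y)) (gaugeAct u Uy) := isMinimiser_gaugeAct hL1 hε.le j (hls j) hUy hu huP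
      rw [hgen1 ub hubu hubP hubfix (Dy y), hcopy] at h; exact h
    -- smallness of `Φ`, the decoded slice decomposition, and the minimiser `chart σΦ`
    have hΦρ : ‖Φ‖ < ρm := by linarith
    have hdec := hdecB (show dist Φ 0 < ρd from by rw [dist_zero_right]; exact hΦρ.trans_le hρmd)
    set gξ : Site 4 → (Matrix n n ℂ)ˣ := fun x => expUnit (ξ Φ (redN (L * tower L N j) x)) with hgξ
    have hgξu : IsUnitarySite gξ := expGauge_isUnitarySite (hprop Φ).1
    have hgξP : IsPeriodicSite gξ ((N * L ^ (j + 1) : ℕ) : ℤ) := by rw [hper]; exact expGauge_isPeriodicSite (ξ Φ)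
    set gi : Site 4 → (Matrix n n ℂ)ˣ := fun x => (gξ x)⁻¹ with hgi
    have hgiu : IsUnitarySite gi := fun x => (unitaryUnits _).inv_mem (hgξu x)
    have hgiP : IsPeriodicSite gi ((N * L ^ (j + 1) : ℕ) : ℤ) := fun x i => by simp only [hgi, hgξP x i]
    have hgich : gaugeAct gi (ch Φ) = ch (σ Φ) := by
      rw [hdec, ← gaugeAct_mul_fun]
      have h2 : (fun x => gi x * gξ x) = fun _ : Site 4 => (1 : (Matrix n n ℂ)ˣ) := by funext x; simp only [hgi, inv_mul_cancel]
      rw [h2, gaugeAct_one]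
    have hgic : (fun z : Site 4 => gi (((L : ℤ) ^ (j + 1)) • z)) = fun _ => (1 : (Matrix n n ℂ)ˣ) := by
      funext z; simp only [hgi, hgξ, (hprop Φ).2.1 z, expUnit_zero, inv_one]
    have hσmin : IsMinimiser 4 (sfClass 4 L N ε) L N (j + 1) (Dy y) (ch (σ Φ)) := by
      have h : IsMinimiser 4 (sfClass 4 L N ε) L N (j + 1) (gaugeAct (fun z : Site 4 => gi (((L : ℤ) ^ (j + 1)) • z)) (Dy y)) (gaugeAct gi (ch Φ)) :=
        isMinimiser_gaugeAct hL1 hε.le j (hls j) hXmin hgiu hgiP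
      rw [hgic, gaugeAct_one, hgich] at h; exact h
    -- the slice element `sΦ`, its datum coordinate `y` and fibre coordinate `zΦ`
    set sΦ : ↥Sl := ⟨((σ Φ : ↥(skewSub 4 n (L * tower L N j))) : TDir 4 n (L * tower L N j)), (hprop Φ).2.2⟩ with hsΦ
    have hsΦn : ‖sΦ‖ = ‖σ Φ‖ := by rw [Submodule.coe_norm, Submodule.coe_norm (x := σ Φ)]
    have hσn : ‖σ Φ‖ ≤ Kσ * ‖Φ‖ := by
      have hΦσ : Φ ∈ tσ := hballσ (mem_ball_zero_iff.mpr (hΦρ.trans_le hρmσ))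
      have h0σ : (0 : ↥(skewSub 4 n (L * tower L N j))) ∈ tσ := hballσ (mem_ball_self hρσ)
      have h := hσL.norm_sub_le hΦσ h0σ
      rw [hσ0, sub_zero, sub_zero] at h; exact h
    have hsΦle : ‖sΦ‖ ≤ (Kσ : ℝ) * C * ‖y‖ := by
      rw [hsΦn]; exact hσn.trans (by nlinarith [hΦn, hKσ0])
    have hsΦρ : ‖sΦ‖ < ρm := by linarith
    have hQs : levelQ L N j Us (chart (ContinuousLinearMap.id ℝ (Matrix n n ℂ)) (L * tower L N j) Us (sΦ : TDir 4 n (L * tower L N j))) = y := by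
      show skewPR N (relLog N (cavgIter L (j + 1) Us) (cavgIter L (j + 1) (ch (σ Φ)))) = y
      rw [hUsavg, cavgIter_eq_avgIter, hσmin.mem.2, hyco]
    set zΦ : ↥KT := πT sΦ with hzΦ
    have hzΦn : ‖zΦ‖ ≤ Kq * ‖sΦ‖ :=
      (hπKB (show dist sΦ 0 < ρk from by rw [dist_zero_right]; exact hsΦρ.trans_le hρmk)).trans
        (mul_le_mul_of_nonneg_right (le_max_left _ _) (norm_nonneg _))
    have hzΦle : ‖zΦ‖ ≤ Kq * ((Kσ : ℝ) * C) * ‖y‖ := hzΦn.trans (by nlinarith [hsΦle, hKq0])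
    have hzΦρ : ‖zΦ‖ < ρm := by linarith
    have hθz : θS (y, iK zΦ) = sΦ := by
      have h := hsecB (show dist sΦ 0 < ρs from by rw [dist_zero_right]; exact hsΦρ.trans_le hρms)
      rw [hQs] at h; exact h
    -- `zΦ` is a local minimum of `z ↦ g(y, z)`, hence THE critical point `z⋆(y)`
    have hlocmin : IsLocalMin (fun z : ↥KT => g (y, z)) zΦ := by
      have hopen : ∀ᶠ z : ↥KT in 𝓝 zΦ, ‖iK z‖ < ρm := by
        have hc : Continuous fun z : ↥KT => ‖iK z‖ := iK.continuous.norm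
        have h0 : ‖iK zΦ‖ < ρm := by rw [hiKn]; exact hzΦρ
        exact (hc.tendsto zΦ).eventually (gt_mem_nhds h0)
      filter_upwards [hopen] with z hz
      have hp : dist ((y, iK z) : ↥(skewSub 4 n N) × ↥Sl) 0 < ρf := by
        rw [dist_zero_right, Prod.norm_mk]; exact (max_lt hyρ hz).trans_le hρmf
      obtain ⟨-, -, hadmD⟩ := hfibB hp
      have hadm := hadmD (Dy y) (hDyu y) (hDyP y) hyn hyco
      have h := hσmin.le _ hadm
      rw [hlev, hlev] at h
      have h2 := le_of_mul_le_mul_left h hw0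
      show g (y, zΦ) ≤ g (y, z)
      simp only [hg, hθz]
      exact h2
    have hcrit : fderiv ℝ (fun z : ↥KT => g (y, z)) zΦ = 0 := hlocmin.fderiv_eq_zero
    have hzs : zs y = zΦ := by
      have hq : dist ((y, zΦ) : ↥(skewSub 4 n N) × ↥KT) 0 < ρu := by
        rw [dist_zero_right, Prod.norm_mk]; exact (max_lt hyρ hzΦρ).trans_le hρmu
      exact (huniqB hq).mp hcrit
    have hΨy : ch (Ψ y) = ch (σ Φ) := by
      show chart (ContinuousLinearMap.id ℝ (Matrix n n ℂ)) (L * tower L N j) Us ((Ψ y : ↥(skewSub 4 n (L * tower L N j))) : TDir 4 n (L * tower L N j))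
        = chart (ContinuousLinearMap.id ℝ (Matrix n n ℂ)) (L * tower L N j) Us ((σ Φ : ↥(skewSub 4 n (L * tower L N j))) : TDir 4 n (L * tower L N j))
      rw [hΨval, hzs, hθz]
    rw [hΨy]; exact hσmin
  -- the minimal action is `w · g(y, z⋆(y))` near `0`, hence `C¹`
  have hminAct : ∀ᶠ y : ↥(skewSub 4 n N) in 𝓝 0, minAct 4 (sfClass 4 L N ε) L N (j + 1) (Dy y) = w * g (y, zs y) :=
    hkey.mono fun y hy => by rw [hy.minAct_eq, hlev]; rfl
  have hgzs : ContDiffAt ℝ 1 (fun y : ↥(skewSub 4 n N) => w * g (y, zs y)) 0 := by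
    have h1 : ContDiffAt ℝ 1 (fun y : ↥(skewSub 4 n N) => ((y, zs y) : ↥(skewSub 4 n N) × ↥KT)) 0 := contDiffAt_id.prodMk hzsc
    have h2 : ContDiffAt ℝ 1 g ((fun y : ↥(skewSub 4 n N) => ((y, zs y) : ↥(skewSub 4 n N) × ↥KT)) 0) := by
      simp only [hzs0, Prod.mk_zero_zero]; exact hgc.of_le (by norm_num)
    have h3 : ContDiffAt ℝ 1 (fun y : ↥(skewSub 4 n N) => g (y, zs y)) 0 :=
      ContDiffAt.comp (g := g) (f := fun y : ↥(skewSub 4 n N) => ((y, zs y) : ↥(skewSub 4 n N) × ↥KT)) 0 h2 h1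
    exact contDiffAt_const.mul h3
  refine ⟨Us, Ψ, hUs, hΨc, hΨ0, hkey, ?_⟩
  exact hgzs.congr_of_eventuallyEq hminAct

end

end Summit.QuantumFields.BalabanUV.T4Continuum.NE7MinimiserC1Generic
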